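import Summits.AtomisticToContinuum.BoseEinsteinCondensation.Theses.BECConjugateDomination
import Summits.AtomisticToContinuum.BoseEinsteinCondensation.Theses.BECPhaseQuadratureSumRule
import Summits.AtomisticToContinuum.BoseEinsteinCondensation.Theorems.BECConjugateDominationNearMinimiserStabilityHelpers
import Literature.MathematicalPhysics.QuantumManyBody.PeriodicFormSpectrum
import Literature.MathematicalPhysics.QuantumManyBody.PeriodicGroundStateNondegenerate
import HarnessLib

/-!
# Route BECConjugateDomination — `NearMinimiserStability` (item stmt-AtomisticToContinuum-11788)

At fixed particle number `N` and side `L`, every `δ`-near-minimiser `Φ` of the periodic `N`-body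
energy has condensate occupation at least that of any minimiser `Ψ` minus `εN`, for `δ = δ(ε) > 0`
(`Summit.AtomisticToContinuum.BoseEinsteinCondensation.Theses.BECConjugateDomination.NearMinimiserStability`),
proved here CONDITIONALLY on the nondegeneracy of the periodic bosonic ground state.

## Proof

* **Min–max (in the tree).** `PeriodicFormSpectrum`: for `W = ∑ v^per ∈ L¹(cell)` the form domain `Q`
  of `q(Ψ) = ∫|∇Ψ|² + W|Ψ|²` is compactly embedded by `ι = formEmbed` in `L²`, the two top eigenpairs
  `(κ₁, e₁), (κ₂, e₂)` of the Gram operator exist (`TwoModeData`), `E₀ = periodicGroundStateEnergy = κ₁⁻¹ - 1`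
  and `kyFanTwo = κ₁⁻¹ + κ₂⁻¹ - 2`.
* **Gap inequality** (`twoModeData_gap_mul_le`, abstract): for `ψ ∈ Q` with `‖ιψ‖ = 1`,
  `(κ₂⁻¹ - κ₁⁻¹)(1 - |⟪ιφ₁, ιψ⟫|²) ≤ ‖ψ‖²_Q - κ₁⁻¹ = q(ψ) - E₀` (split `ψ` along `e₁`).
* **Nondegeneracy** (NAMED FACT `Literature.MathematicalPhysics.QuantumManyBody.PeriodicGroundStateNondegenerate`, Perron–Frobenius on the torus,
  Reed–Simon IV §XIII.12): `2E₀ < kyFanTwo`, i.e. `κ₂ < κ₁`, so the gap `κ₂⁻¹ - κ₁⁻¹` is `> 0`. Hence a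
  minimiser `Ψ` is `ιΨ = c • ιφ₁` (`|c| = 1`) and a `δ`-near-minimiser `Φ` has, after a phase
  alignment, `‖ιΨ - c'•ιΦ‖² ≤ 2δ/gap` (`twoModeData_exists_phase_norm_sub_sq_le`, abstract).
* **`n₀` is `2N`-Lipschitz on the unit sphere** (`condensateOccupation_le_of_sub_le`, helpers file):
  `n₀(Ψ) ≤ n₀(c'Φ) + N(2η + η²)` when `∫_cell|Ψ - c'Φ|² ≤ η²`; with `η = min(ε/3, 1)` and
  `δ = gap·η²/2` this is `n₀(Ψ) ≤ n₀(Φ) + εN`.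

The only non-formalised input is the named fact (simplicity of the bosonic ground state of `-Δ + V` on
the torus for bounded `V`; in the tree the positivity-improving theory exists abstractly,
`Literature.Analysis.OperatorTheory.PositivityImproving`, and through Feynman–Kac as the named fact
`PeriodicGroundStateFeynmanKac`, but not yet bridged to the form-domain spectral data).
-/

noncomputable section

open MeasureTheory Filter Set Complex
open scoped ENNReal NNReal Topology ComplexConjugate InnerProductSpace

namespace Summit.AtomisticToContinuum.BoseEinsteinCondensation.Theorems

open Literature.MathematicalPhysics.QuantumManyBody.BoseGas Literature.Analysis.InnerProduct

/-! ### Abstract Hilbert-space lemmas -/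

section Abstract

variable {E : Type*} [NormedAddCommGroup E] [InnerProductSpace ℂ E]

/-- **Phase alignment.** For vectors `a, b` of a complex inner product space there is a phase `c`,
`‖c‖ = 1`, with `‖a - c • b‖² = ‖a‖² + ‖b‖² - 2‖⟪a, b⟫‖` (choose `c = conj⟪a,b⟫/‖⟪a,b⟫‖`). [folklore] -/
theorem exists_phase_norm_sub_sq_eq (a b : E) :
    ∃ c : ℂ, ‖c‖ = 1 ∧ ‖a - c • b‖ ^ 2 = ‖a‖ ^ 2 + ‖b‖ ^ 2 - 2 * ‖⟪a, b⟫_ℂ‖ := by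
  by_cases hz : ⟪a, b⟫_ℂ = 0
  · refine ⟨1, norm_one, ?_⟩
    rw [one_smul, @norm_sub_sq ℂ, hz]
    simp
  · have hn : ‖⟪a, b⟫_ℂ‖ ≠ 0 := norm_ne_zero_iff.2 hz
    refine ⟨conj ⟪a, b⟫_ℂ / (‖⟪a, b⟫_ℂ‖ : ℂ), ?_, ?_⟩
    · rw [norm_div, RCLike.norm_conj, Complex.norm_real, Real.norm_of_nonneg (norm_nonneg _),
        div_self hn]
    · rw [@norm_sub_sq ℂ, inner_smul_right, norm_smul, norm_div, RCLike.norm_conj, Complex.norm_real,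
        Real.norm_of_nonneg (norm_nonneg _), div_self hn, one_mul]
      have hre : RCLike.re (conj ⟪a, b⟫_ℂ / (‖⟪a, b⟫_ℂ‖ : ℂ) * ⟪a, b⟫_ℂ) = ‖⟪a, b⟫_ℂ‖ := by
        rw [div_mul_eq_mul_div, Complex.conj_mul', ← Complex.ofReal_pow, ← Complex.ofReal_div,
          RCLike.re_to_complex, Complex.ofReal_re, sq, mul_div_assoc, div_self hn, mul_one]
      rw [hre]
      ring

/-- For unit vectors the aligned distance is `2 - 2‖⟪a, b⟫‖ ≤ 2(1 - ‖⟪a, b⟫‖²)`. [folklore] -/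
theorem exists_phase_norm_sub_sq_le {a b : E} (ha : ‖a‖ = 1) (hb : ‖b‖ = 1) :
    ∃ c : ℂ, ‖c‖ = 1 ∧ ‖a - c • b‖ ^ 2 ≤ 2 * (1 - ‖⟪a, b⟫_ℂ‖ ^ 2) := by
  obtain ⟨c, hc, h⟩ := exists_phase_norm_sub_sq_eq a b
  refine ⟨c, hc, ?_⟩
  have h1 : ‖⟪a, b⟫_ℂ‖ ≤ 1 := by
    have := norm_inner_le_norm (𝕜 := ℂ) a b
    rwa [ha, hb, mul_one] at this
  rw [h, ha, hb]
  nlinarith [norm_nonneg ⟪a, b⟫_ℂ]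

variable {Q : Type*} [NormedAddCommGroup Q] [InnerProductSpace ℂ Q] [CompleteSpace Q] [CompleteSpace E]

/-- **The gap inequality of the two lowest form eigenvalues.** For the spectral data `d` of an
embedding `ι : Q → E` and `ψ ∈ Q` with `‖ιψ‖ = 1`:
`(κ₂⁻¹ - κ₁⁻¹)(1 - ‖⟪ιφ₁, ιψ⟫‖²) ≤ ‖ψ‖²_Q - κ₁⁻¹`; in form language
`q(ψ) - E₁ ≥ (E₂ - E₁)(1 - |⟨φ₁, ψ⟩|²)`. Proof: split `ψ = ⟪e₁,ψ⟫e₁ + ψ'`, `ψ' ⊥ e₁`; then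
`‖ψ‖² = |a|² + ‖ψ'‖²`, `1 = |a|²κ₁ + ‖ιψ'‖²`, `‖ιψ'‖² ≤ κ₂‖ψ'‖²`, `‖⟪ιφ₁, ιψ⟫‖² = κ₁|a|²`.
[cite: ReedSimonIV1978, Thm. XIII.1] -/
theorem twoModeData_gap_mul_le {ι : Q →L[ℂ] E} (d : TwoModeData ι) {ψ : Q} (hψ : ‖ι ψ‖ = 1) :
    (d.κ₂⁻¹ - d.κ₁⁻¹) * (1 - ‖⟪ι d.φ₁, ι ψ⟫_ℂ‖ ^ 2) ≤ ‖ψ‖ ^ 2 - d.κ₁⁻¹ := by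
  have hκ₁ := d.κ₁_pos
  have hκ₂ := d.κ₂_pos
  set a : ℂ := ⟪d.e₁, ψ⟫_ℂ with ha
  set ψ' : Q := ψ - a • d.e₁ with hψ'
  have horth : ⟪d.e₁, ψ'⟫_ℂ = 0 := by
    rw [hψ', inner_sub_right, inner_smul_right, inner_self_eq_norm_sq_to_K, d.norm_e₁]; simp [ha]
  have hdec : ψ = a • d.e₁ + ψ' := by rw [hψ']; abel
  -- `‖ψ‖² = |a|² + ‖ψ'‖²`
  have hA : ‖ψ‖ ^ 2 = ‖a‖ ^ 2 + ‖ψ'‖ ^ 2 := by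
    have h0 : ⟪a • d.e₁, ψ'⟫_ℂ = 0 := by rw [inner_smul_left, horth, mul_zero]
    have := norm_add_sq_eq_norm_sq_add_norm_sq_of_inner_eq_zero _ _ h0
    rw [← hdec, norm_smul, d.norm_e₁, mul_one] at this
    simpa only [sq] using this
  -- `1 = |a|²κ₁ + ‖ιψ'‖²`
  have hB : 1 = ‖a‖ ^ 2 * d.κ₁ + ‖ι ψ'‖ ^ 2 := by
    have h0 : ⟪ι (a • d.e₁), ι ψ'⟫_ℂ = 0 := by
      rw [map_smul, inner_smul_left, d.inner_map_e₁, horth]; simp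
    have := norm_add_sq_eq_norm_sq_add_norm_sq_of_inner_eq_zero _ _ h0
    rw [← map_add, ← hdec, hψ, map_smul, norm_smul] at this
    rw [← d.norm_map_e₁_sq]
    linear_combination this
  -- `‖ιψ'‖² ≤ κ₂‖ψ'‖²`
  have hC : ‖ι ψ'‖ ^ 2 ≤ d.κ₂ * ‖ψ'‖ ^ 2 := d.norm_sq_le_two ψ' horth
  -- `‖⟪ιφ₁, ιψ⟫‖² = κ₁|a|²`
  have hD : ‖⟪ι d.φ₁, ι ψ⟫_ℂ‖ ^ 2 = d.κ₁ * ‖a‖ ^ 2 := by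
    rw [TwoModeData.φ₁, map_smul, inner_smul_left, d.inner_map_e₁, ← ha, norm_mul, norm_mul,
      RCLike.norm_conj, RCLike.norm_ofReal, RCLike.norm_ofReal,
      abs_of_nonneg (inv_nonneg.2 (Real.sqrt_nonneg _)), abs_of_nonneg hκ₁.le, mul_pow, mul_pow,
      inv_pow, Real.sq_sqrt hκ₁.le]
    field_simp
  rw [hD, hA]
  -- the algebra: `X = ‖ψ'‖²`, `Y = ‖ιψ'‖² = 1 - κ₁|a|²`, `Y ≤ κ₂ X`
  set A := ‖a‖ ^ 2 with hAdef
  set X := ‖ψ'‖ ^ 2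
  set Y := ‖ι ψ'‖ ^ 2
  have hY : Y = 1 - A * d.κ₁ := by linarith
  have hX : (1 - A * d.κ₁) / d.κ₂ ≤ X := by
    rw [div_le_iff₀ hκ₂]; nlinarith
  have hgoal : (d.κ₂⁻¹ - d.κ₁⁻¹) * (1 - d.κ₁ * A) = A + (1 - A * d.κ₁) / d.κ₂ - d.κ₁⁻¹ := by
    field_simp
    ring
  rw [hgoal]
  linarith

/-- **Near-minimisers are close to a minimiser up to a phase** (abstract form of the stability
argument). Let `d` be the spectral data of `ι : Q → E` with a GAP `κ₁⁻¹ < κ₂⁻¹` (simple lowest form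
eigenvalue). If `u, w ∈ Q` are `E`-normalised, `u` is a minimiser (`‖u‖²_Q ≤ κ₁⁻¹`) and `w` is a
near-minimiser (`‖w‖²_Q ≤ κ₁⁻¹ + (κ₂⁻¹ - κ₁⁻¹) t/2`), then `‖ιu - c•ιw‖² ≤ t` for a phase `c`:
the gap inequality gives `|⟪ιφ₁, ιu⟫| = 1` (so `ιu = c₁•ιφ₁`) and `1 - |⟪ιφ₁, ιw⟫|² ≤ t/2`, and
phase alignment gives `‖ιu - c•ιw‖² ≤ 2(1 - |⟪ιu, ιw⟫|²)`. [cite: ReedSimonIV1978, Thm. XIII.1] -/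
theorem twoModeData_exists_phase_norm_sub_sq_le {ι : Q →L[ℂ] E} (d : TwoModeData ι)
    (hgap : d.κ₁⁻¹ < d.κ₂⁻¹) {u w : Q} (hu : ‖ι u‖ = 1) (hw : ‖ι w‖ = 1) {t : ℝ}
    (hQu : ‖u‖ ^ 2 ≤ d.κ₁⁻¹) (hQw : ‖w‖ ^ 2 ≤ d.κ₁⁻¹ + (d.κ₂⁻¹ - d.κ₁⁻¹) * (t / 2)) :
    ∃ c : ℂ, ‖c‖ = 1 ∧ ‖ι u - c • ι w‖ ^ 2 ≤ t := by
  have hg0 : 0 < d.κ₂⁻¹ - d.κ₁⁻¹ := sub_pos.2 hgap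
  have hgu := twoModeData_gap_mul_le d hu
  have hgw := twoModeData_gap_mul_le d hw
  have hp1 : ‖ι d.φ₁‖ = 1 := d.norm_map_φ₁
  -- the minimiser is the ground state up to a phase
  have hsu_le : ‖⟪ι d.φ₁, ι u⟫_ℂ‖ ≤ 1 := by
    calc ‖⟪ι d.φ₁, ι u⟫_ℂ‖ ≤ ‖ι d.φ₁‖ * ‖ι u‖ := norm_inner_le_norm _ _
      _ = 1 := by rw [hp1, hu, mul_one]
  have hsu : ‖⟪ι d.φ₁, ι u⟫_ℂ‖ = 1 := by
    have hge : 1 ≤ ‖⟪ι d.φ₁, ι u⟫_ℂ‖ ^ 2 := by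
      by_contra hlt
      have : 0 < (d.κ₂⁻¹ - d.κ₁⁻¹) * (1 - ‖⟪ι d.φ₁, ι u⟫_ℂ‖ ^ 2) := mul_pos hg0 (by linarith)
      linarith
    nlinarith [norm_nonneg ⟪ι d.φ₁, ι u⟫_ℂ]
  obtain ⟨c₁, hc₁, hc₁eq⟩ := exists_phase_norm_sub_sq_eq (ι u) (ι d.φ₁)
  rw [hu, hp1, norm_inner_symm, hsu] at hc₁eq
  have huc : ι u = c₁ • ι d.φ₁ := by
    have h0 : ‖ι u - c₁ • ι d.φ₁‖ ^ 2 = 0 := by rw [hc₁eq]; norm_num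
    rwa [sq_eq_zero_iff, norm_eq_zero, sub_eq_zero] at h0
  -- the near-minimiser overlaps with the ground state
  have hsw : 1 - ‖⟪ι d.φ₁, ι w⟫_ℂ‖ ^ 2 ≤ t / 2 := by
    have : (d.κ₂⁻¹ - d.κ₁⁻¹) * (1 - ‖⟪ι d.φ₁, ι w⟫_ℂ‖ ^ 2) ≤ (d.κ₂⁻¹ - d.κ₁⁻¹) * (t / 2) := by
      linarith
    exact le_of_mul_le_mul_left this hg0
  -- phase alignment
  obtain ⟨c, hc, hdist⟩ := exists_phase_norm_sub_sq_le hu hw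
  have hinner : ‖⟪ι u, ι w⟫_ℂ‖ = ‖⟪ι d.φ₁, ι w⟫_ℂ‖ := by
    rw [huc, inner_smul_left, norm_mul, RCLike.norm_conj, hc₁, one_mul]
  refine ⟨c, hc, ?_⟩
  rw [hinner] at hdist
  linarith

end Abstract

/-! ### The theorem -/
set_option maxHeartbeats 400000 in
/-- **Near-minimiser stability of the condensate occupation (route `BECConjugateDomination`,
item stmt-AtomisticToContinuum-11788), conditional on the nondegeneracy of the periodic ground
state.** For a smooth-class potential (repulsive, finite range, finite, `C²` as `x ↦ v(|x|)`), fixed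
`N`, `L > 0` with `E₀ = periodicGroundStateEnergy v N L < ∞` and `ε > 0`, there is `δ > 0` such that
every minimiser `Ψ` and every `δ`-near-minimiser `Φ` (periodic `C¹` Bose trial states) satisfy
`n₀(Ψ) ≤ n₀(Φ) + εN`. Proof: min–max in the form domain (`TwoModeData` of `formEmbed`: `E₀ = κ₁⁻¹ - 1`,
`kyFanTwo = κ₁⁻¹ + κ₂⁻¹ - 2`), the gap inequality `q(ψ) - E₀ ≥ (κ₂⁻¹ - κ₁⁻¹)(1 - |⟨φ₁, ψ⟩|²)`,
the gap `κ₂⁻¹ - κ₁⁻¹ > 0` from `PeriodicGroundStateNondegenerate`, phase alignment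
`‖Ψ - c'Φ‖²_cell ≤ 2(1 - |⟨Ψ, Φ⟩|²) ≤ η²` for `δ = gap·η²/2`, and the Lipschitz bound
`n₀(Ψ) ≤ n₀(c'Φ) + N(2η + η²)`, `η = min(ε/3, 1)`; `N = 0` is trivial (`n₀ = 0`).
[cite: ReedSimonIV1978, Thm. XIII.1 and §XIII.12 Thms XIII.43–XIII.46] -/
theorem nearMinimiserStability_of_nondegenerate
    (hND : Literature.MathematicalPhysics.QuantumManyBody.PeriodicGroundStateNondegenerate) :
    Theses.BECConjugateDomination.NearMinimiserStability := by
  intro v hv hfin hC2 _hedge N L hL _hE0 ε hε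
  obtain ⟨hmeas, R₀, hR₀⟩ := hv
  rcases N with _ | n
  · -- no particles: `n₀ = 0`
    refine ⟨1, one_pos, fun Ψ Φ _ _ => ?_⟩
    simp [condensateOccupation, occupation]
  -- bounded periodisation, `W ∈ L¹(cell)`
  obtain ⟨M, hM⟩ := exists_bound_of_continuous_finiteRange hfin hC2.continuous hR₀
  obtain ⟨C, hC⟩ := exists_bound_periodizedPotential_of_space hL hM hR₀
  have hW : ∫⁻ X in cellN (n + 1) L, periodicInteraction v L X ≠ ⊤ :=
    lintegral_periodicInteraction_ne_top hC (n + 1)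
  -- the graph map into the form domain `Q` and the embedding `ι : Q → H = L²`
  set J := (graphEmbed hL hmeas hW).codRestrict (formDomain hL hmeas hW)
    (graphEmbed_mem_formDomain hL hmeas hW) with hJ
  have hJapply : ∀ F : periodicCore (n + 1) L,
      J F = ⟨graphEmbed hL hmeas hW F, graphEmbed_mem_formDomain hL hmeas hW F⟩ := fun F => rfl
  set ι := formEmbed hL hmeas hW with hι
  -- spectral data of the two lowest eigenvalues, and the gap
  obtain ⟨d⟩ := nonempty_twoModeData hL hmeas hW (Nat.succ_pos n)
  have hE₀ : periodicGroundStateEnergy v (n + 1) L = ENNReal.ofReal (d.κ₁⁻¹ - 1) :=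
    periodicGroundStateEnergy_eq_ofReal d
  have h1 : 1 ≤ d.κ₁⁻¹ := twoModeData_one_le_inv_κ₁ d
  have hgap : d.κ₁⁻¹ < d.κ₂⁻¹ := by
    have hlt := hND (n + 1) L v (Nat.succ_pos n) hL hmeas ⟨C, hC⟩
    rw [hE₀, kyFanTwo_eq_ofReal d,
      show (2 : ℝ≥0∞) * ENNReal.ofReal (d.κ₁⁻¹ - 1) = ENNReal.ofReal (2 * (d.κ₁⁻¹ - 1)) by
        rw [ENNReal.ofReal_mul zero_le_two, ENNReal.ofReal_ofNat],
      ENNReal.ofReal_lt_ofReal_iff_of_nonneg (by linarith)] at hlt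
    linarith
  have hg0 : 0 < d.κ₂⁻¹ - d.κ₁⁻¹ := sub_pos.2 hgap
  -- the tolerance
  set η : ℝ := min (ε / 3) 1 with hη
  have hη0 : 0 < η := lt_min (by linarith) one_pos
  have hη1 : η ≤ 1 := min_le_right _ _
  have hηε : 2 * η + η ^ 2 ≤ ε := by nlinarith [min_le_left (ε / 3) 1]
  refine ⟨ENNReal.ofReal ((d.κ₂⁻¹ - d.κ₁⁻¹) * (η ^ 2 / 2)),
    ENNReal.ofReal_pos.2 (by positivity), fun Ψ Φ hΨ hΦ => ?_⟩
  -- the vectors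
  set FΨ : periodicCore (n + 1) L := ⟨Ψ.ψ, Ψ.mem_periodicCore⟩ with hFΨ
  set FΦ : periodicCore (n + 1) L := ⟨Φ.ψ, Φ.mem_periodicCore⟩ with hFΦ
  have huΨ : ‖ι (J FΨ)‖ = 1 := norm_formEmbed_graphEmbed_trialState hL hmeas hW Ψ
  have huΦ : ‖ι (J FΦ)‖ = 1 := norm_formEmbed_graphEmbed_trialState hL hmeas hW Φ
  have hnormJ : ∀ F : periodicCore (n + 1) L, ‖J F‖ = ‖graphEmbed hL hmeas hW F‖ := fun F => by
    rw [hJapply]; rfl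
  have hQΨ : ‖J FΨ‖ ^ 2 = 1 + (periodicEnergy v Ψ).toReal := by
    rw [hnormJ]; exact norm_graphEmbed_sq_trialState hL hmeas hW Ψ
  have hQΦ : ‖J FΦ‖ ^ 2 = 1 + (periodicEnergy v Φ).toReal := by
    rw [hnormJ]; exact norm_graphEmbed_sq_trialState hL hmeas hW Φ
  -- energies as real numbers
  have hEΨ : (periodicEnergy v Ψ).toReal = d.κ₁⁻¹ - 1 := by
    rw [hΨ, hE₀, ENNReal.toReal_ofReal (by linarith)]
  have hEΦ : (periodicEnergy v Φ).toReal ≤ d.κ₁⁻¹ - 1 + (d.κ₂⁻¹ - d.κ₁⁻¹) * (η ^ 2 / 2) := by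
    rw [hE₀, ← ENNReal.ofReal_add (by linarith) (by positivity)] at hΦ
    have := ENNReal.toReal_mono ENNReal.ofReal_ne_top hΦ
    rwa [ENNReal.toReal_ofReal (by nlinarith [sq_nonneg η])] at this
  -- the abstract stability argument: `‖ιΨ - c'•ιΦ‖² ≤ η²`
  obtain ⟨c', hc', hdist'⟩ := twoModeData_exists_phase_norm_sub_sq_le (ι := ι) d hgap
    (u := J FΨ) (w := J FΦ) huΨ huΦ (t := η ^ 2) (by linarith) (by linarith)
  -- back to functions on the cell: `∫_cell |Ψ - c'Φ|² ≤ η²`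
  have hcore : ι (J FΨ) - c' • ι (J FΦ) = ι (J (FΨ - c' • FΦ)) := by
    simp only [map_sub, map_smul]
  have hfun : ((FΨ - c' • FΦ : periodicCore (n + 1) L) : Config (n + 1) → ℂ) =
      fun X => Ψ.ψ X - c' * Φ.ψ X := by
    ext X
    simp [hFΨ, hFΦ]
  have hcontd : Continuous fun X => Ψ.ψ X - c' * Φ.ψ X :=
    Ψ.contDiff.continuous.sub (continuous_const.mul Φ.contDiff.continuous)
  have hcell : ∫⁻ X in cellN (n + 1) L, (‖Ψ.ψ X - c' * Φ.ψ X‖₊ : ℝ≥0∞) ^ 2 ≤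
      ENNReal.ofReal (η ^ 2) := by
    have hnorm : ‖ι (J (FΨ - c' • FΦ))‖ ^ 2 =
        (∫⁻ X in cellN (n + 1) L,
          (‖((FΨ - c' • FΦ : periodicCore (n + 1) L) : Config (n + 1) → ℂ) X‖₊ : ℝ≥0∞) ^ 2).toReal :=
      norm_formEmbed_graphEmbed_sq hL hmeas hW (FΨ - c' • FΦ)
    simp only [hfun, ← hcore] at hnorm
    have hfin' : (∫⁻ X in cellN (n + 1) L, (‖Ψ.ψ X - c' * Φ.ψ X‖₊ : ℝ≥0∞) ^ 2) ≠ ⊤ :=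
      (lintegral_cellN_sq_lt_top L hcontd).ne
    rw [← ENNReal.ofReal_toReal hfin', ← hnorm]
    exact ENNReal.ofReal_le_ofReal hdist'
  -- the Lipschitz estimate for `n₀`
  have hc'n : ((‖c'‖₊ : ℝ≥0) : ℝ≥0∞) = 1 := by
    rw [← ENNReal.coe_one, ENNReal.coe_inj, ← NNReal.coe_inj, coe_nnnorm, hc', NNReal.coe_one]
  have hcontg : Continuous fun X => c' * Φ.ψ X := continuous_const.mul Φ.contDiff.continuous
  have hg1 : ∫⁻ X in cellN (n + 1) L, (‖c' * Φ.ψ X‖₊ : ℝ≥0∞) ^ 2 ≤ 1 := by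
    have hX : ∀ X, (‖c' * Φ.ψ X‖₊ : ℝ≥0∞) ^ 2 = (‖Φ.ψ X‖₊ : ℝ≥0∞) ^ 2 := fun X => by
      rw [nnnorm_mul, ENNReal.coe_mul, mul_pow, hc'n, one_pow, one_mul]
    simp only [hX]
    rw [Φ.norm_eq]
  have hmain := condensateOccupation_le_of_sub_le hL Ψ.contDiff.continuous hcontg hg1 hη0 hcell
  rw [condensateOccupation_const_mul hL c' Φ.ψ, hc'n, one_pow, one_mul] at hmain
  refine hmain.trans (add_le_add le_rfl (ENNReal.ofReal_le_ofReal ?_))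
  rw [mul_comm]
  exact mul_le_mul_of_nonneg_right hηε (Nat.cast_nonneg _)

/-- The twin item of route `BECPhaseQuadratureSumRule` (the same statement, verbatim), equally
conditional on `PeriodicGroundStateNondegenerate`. [cite: ReedSimonIV1978, Thm. XIII.1] -/
theorem phaseQuadrature_nearMinimiserStability_of_nondegenerate
    (hND : Literature.MathematicalPhysics.QuantumManyBody.PeriodicGroundStateNondegenerate) :
    Theses.BECPhaseQuadratureSumRule.NearMinimiserStability :=
  nearMinimiserStability_of_nondegenerate hND

end Summit.AtomisticToContinuum.BoseEinsteinCondensation.Theorems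

end
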